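import Literature.AlgebraicGeometry.Motives.PicardQuarticAffineChart
import Mathlib.AlgebraicGeometry.FunctionField
import Mathlib.RingTheory.Localization.Integral
import HarnessLib

/-!
# The function field of the Picard quartic is `K(x)[y]/(y³ - g)`

For a separable quartic `g ∈ K[X]` (`3 ≠ 0` in `K`), the smooth plane quartic
`X_F = V₊(y³z - z⁴g(x/z)) ⊂ ℙ²_K` (`Motives/PicardQuarticHypersurface`) with its affine chart
`Spec K[x][y]/(y³ - g) ≅ {z ≠ 0}` (`Motives/PicardQuarticAffineChart`) has function field the
superelliptic function field `K(x)[y]/(y³ - g) = SuperellipticFunctionField K K 3 g` of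
`GaloisRepresentations/SuperellipticFunctionField` — the field on which the tree's function-field
theory of the Picard curve (places, divisor classes, Tate modules, Frobenius, zeta function) is built:

* `toFunctionField : K[x][y]/(y³ - g) →+* K(x)[y]/(y³ - g)` (`x ↦ x`, `y ↦ y`), injective
  (`toFunctionField_injective`: `y³ - g` is monic, Gauss's lemma `Polynomial.map_dvd_map`), the
  corresponding `Algebra` instance with its scalar towers over `K[x]` and `K`, and
  **`isFractionRing_functionField : IsFractionRing (K[x][y]/(y³ - g)) (K(x)[y]/(y³ - g))`**
  (denominators cleared by Mathlib `IsLocalization.integerNormalization`), for `y³ - g` irreducible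
  over `K(x)`.
* `sectionsChartOpenEquiv : Γ(X_F, {z ≠ 0}) ≃+* K[x][y]/(y³ - g)` (Mathlib `Scheme.Hom.appIso`,
  `Scheme.ΓSpecIso`) and **`functionFieldEquiv : K(X_F) ≃+* K(x)[y]/(y³ - g)`** — both sides are
  fraction fields of `K[x][y]/(y³ - g)` (Mathlib `functionField_isFractionRing_of_isAffineOpen`,
  `IsFractionRing.isFractionRing_iff_of_base_ringEquiv`, `IsLocalization.algEquiv`); integrality of
  `X_F` (`isIntegral_hypersurface_picardForm`) enters as an instance hypothesis.

Everything is proved; no named facts (D-0026). Not yet here: `K`-linearity of `functionFieldEquiv`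
for the structure `RatFn.algebraStalk` (it holds because the chart is a morphism over `Spec K`), the
induced bijection of places (`Motives/CurvePlaces`) and the `Aut(Ω/k)`-equivariant version over an
algebraically closed `Ω ⊇ k`.

## References

* R. Hartshorne, *Algebraic Geometry*, GTM 52 (1977): II Ex. 3.6 (function field of an integral
  scheme), I Thm. 3.4. [Hartshorne1977]
* H. Stichtenoth, *Algebraic Function Fields and Codes*, 2nd ed. (2009), App. B (curves and function
  fields). [Stichtenoth2009]
-/

noncomputable section

open MvPolynomial

universe u

namespace Literature.AlgebraicGeometry.Motives.PicardQuartic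

/-! ### `K(x)[y]/(y³ - g)` is the fraction field of `K[x][y]/(y³ - g)` -/

section FractionField

open Literature.NumberTheory.GaloisRepresentations

variable {K : Type u} [Field K] (g : Polynomial K)

/-- `superellipticPoly K K 3 g` is the image of `Y³ - g(x)` in `K(x)[Y]`. [folklore] -/
theorem map_cubicPoly :
    (cubicPoly g).map (algebraMap (Polynomial K) (RatFunc K)) = superellipticPoly K K 3 g := by
  rw [superellipticPoly, Algebra.algebraMap_self, Polynomial.map_id]
  simp [cubicPoly, Polynomial.map_sub, Polynomial.map_pow, Polynomial.map_X]

/-- `Y³ - g(x)` dies in `K(x)[y]/(y³ - g)`. [folklore] -/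
theorem eval₂_cubicPoly_root :
    Polynomial.eval₂ ((algebraMap (RatFunc K) (SuperellipticFunctionField K K 3 g)).comp
      (algebraMap (Polynomial K) (RatFunc K))) (AdjoinRoot.root (superellipticPoly K K 3 g)) (cubicPoly g) = 0 := by
  rw [← Polynomial.eval₂_map, map_cubicPoly, ← Polynomial.aeval_def, AdjoinRoot.aeval_eq, AdjoinRoot.mk_self]

/-- **`K[x][y]/(y³ - g) → K(x)[y]/(y³ - g)`** (`x ↦ x`, `y ↦ y`; Mathlib `AdjoinRoot.lift`). [folklore] -/
def toFunctionField : affineRing g →+* SuperellipticFunctionField K K 3 g :=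
  AdjoinRoot.lift ((algebraMap (RatFunc K) (SuperellipticFunctionField K K 3 g)).comp
    (algebraMap (Polynomial K) (RatFunc K))) (AdjoinRoot.root (superellipticPoly K K 3 g))
    (eval₂_cubicPoly_root g)

/-- `toFunctionField (q mod (y³ - g)) = q mod (y³ - g)` (coefficients read in `K(x)`). [folklore] -/
theorem toFunctionField_mk (q : Polynomial (Polynomial K)) :
    toFunctionField g (AdjoinRoot.mk _ q) =
      AdjoinRoot.mk (superellipticPoly K K 3 g) (q.map (algebraMap (Polynomial K) (RatFunc K))) := by
  rw [toFunctionField, AdjoinRoot.lift_mk, ← Polynomial.eval₂_map, ← Polynomial.aeval_def, AdjoinRoot.aeval_eq]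

/-- `toFunctionField` on `K[x]`. [folklore] -/
theorem toFunctionField_of (b : Polynomial K) :
    toFunctionField g (AdjoinRoot.of _ b) =
      algebraMap (RatFunc K) (SuperellipticFunctionField K K 3 g) (algebraMap (Polynomial K) (RatFunc K) b) := by
  rw [toFunctionField, AdjoinRoot.lift_of, RingHom.comp_apply]

/-- **`K[x][y]/(y³ - g) → K(x)[y]/(y³ - g)` is injective** (`y³ - g` is monic: Gauss's lemma
`Polynomial.map_dvd_map`). [folklore] -/
theorem toFunctionField_injective : Function.Injective (toFunctionField g) := by
  rw [injective_iff_map_eq_zero]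
  intro a ha
  obtain ⟨q, rfl⟩ := AdjoinRoot.mk_surjective a
  rw [toFunctionField_mk, AdjoinRoot.mk_eq_zero, ← map_cubicPoly,
    Polynomial.map_dvd_map _ (IsFractionRing.injective (Polynomial K) (RatFunc K))
      (Polynomial.monic_X_pow_sub_C g three_ne_zero)] at ha
  exact AdjoinRoot.mk_eq_zero.mpr ha

/-- The `K[x][y]/(y³ - g)`-algebra structure of `K(x)[y]/(y³ - g)`. [folklore] -/
instance algebraFunctionField : Algebra (affineRing g) (SuperellipticFunctionField K K 3 g) :=
  (toFunctionField g).toAlgebra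

/-- `algebraMap = toFunctionField` (`rfl`). [folklore] -/
theorem algebraMap_functionField_eq :
    algebraMap (affineRing g) (SuperellipticFunctionField K K 3 g) = toFunctionField g := rfl

/-- `K[x] → K[x][y]/(y³-g) → K(x)[y]/(y³-g)` is `K[x] → K(x) → K(x)[y]/(y³-g)`. [folklore] -/
instance isScalarTower_polynomial :
    IsScalarTower (Polynomial K) (affineRing g) (SuperellipticFunctionField K K 3 g) :=
  IsScalarTower.of_algebraMap_eq fun b => by
    rw [algebraMap_functionField_eq, AdjoinRoot.algebraMap_eq, toFunctionField_of,
      ← IsScalarTower.algebraMap_apply]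

/-- `K → K[x][y]/(y³-g) → K(x)[y]/(y³-g)` is `K → K(x)[y]/(y³-g)`. [folklore] -/
instance isScalarTower_base : IsScalarTower K (affineRing g) (SuperellipticFunctionField K K 3 g) :=
  IsScalarTower.of_algebraMap_eq fun c => by
    rw [IsScalarTower.algebraMap_apply K (Polynomial K) (affineRing g),
      ← IsScalarTower.algebraMap_apply (Polynomial K) (affineRing g),
      ← IsScalarTower.algebraMap_apply K (Polynomial K)]

/-- Every element of `K(x)[y]/(y³ - g)` is `(q mod (y³ - g)) / b` with `q ∈ K[x][Y]`, `0 ≠ b ∈ K[x]`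
(clear denominators: Mathlib `IsLocalization.integerNormalization`). [folklore] -/
theorem exists_mul_algebraMap_eq (z : SuperellipticFunctionField K K 3 g) :
    ∃ (q : Polynomial (Polynomial K)) (b : Polynomial K), b ≠ 0 ∧
      z * algebraMap (affineRing g) _ (AdjoinRoot.of _ b) = algebraMap (affineRing g) _ (AdjoinRoot.mk _ q) := by
  obtain ⟨Q, rfl⟩ := AdjoinRoot.mk_surjective z
  obtain ⟨b, hb, hq⟩ := IsLocalization.integerNormalization_spec (nonZeroDivisors (Polynomial K)) Q
  refine ⟨IsLocalization.integerNormalization (nonZeroDivisors (Polynomial K)) Q, b,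
    nonZeroDivisors.ne_zero hb, ?_⟩
  rw [algebraMap_functionField_eq, toFunctionField_mk, hq, toFunctionField_of, Algebra.smul_def,
    Polynomial.algebraMap_apply, map_mul, AdjoinRoot.mk_C, ← AdjoinRoot.algebraMap_eq, mul_comm]

/-- **`K(x)[y]/(y³ - g)` is the field of fractions of `K[x][y]/(y³ - g)`** (when `y³ - g` is irreducible
over `K(x)`, e.g. `g` separable non-constant). [folklore] -/
instance isFractionRing_functionField [Fact (Irreducible (superellipticPoly K K 3 g))] :
    IsFractionRing (affineRing g) (SuperellipticFunctionField K K 3 g) := by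
  have hinj := toFunctionField_injective g
  have hdeg : (cubicPoly g).degree ≠ 0 := by
    rw [Polynomial.degree_X_pow_sub_C (by norm_num) g]
    norm_num
  have hof : Function.Injective (AdjoinRoot.of (cubicPoly g)) := AdjoinRoot.of.injective_of_degree_ne_zero hdeg
  haveI : Nontrivial (affineRing g) := hof.nontrivial
  refine ⟨?_, fun z => ?_, fun {x y} h => ⟨1, by rw [hinj h]⟩⟩
  · rintro ⟨y, hy⟩
    refine isUnit_iff_ne_zero.mpr fun h => nonZeroDivisors.ne_zero hy (hinj ?_)
    rwa [map_zero]
  · obtain ⟨q, b, hb, h⟩ := exists_mul_algebraMap_eq g z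
    haveI : IsDomain (affineRing g) := by
      refine AdjoinRoot.isDomain_of_prime (Irreducible.prime ?_)
      rw [(Polynomial.monic_X_pow_sub_C g three_ne_zero).irreducible_iff_irreducible_map_fraction_map
        (K := RatFunc K)]
      change Irreducible ((cubicPoly g).map _)
      rw [map_cubicPoly]
      exact Fact.out
    refine ⟨(AdjoinRoot.mk _ q, ⟨AdjoinRoot.of _ b, mem_nonZeroDivisors_of_ne_zero ?_⟩), h⟩
    rw [Ne, ← map_zero (AdjoinRoot.of (cubicPoly g)), hof.eq_iff]
    exact hb

end FractionField


/-! ### The function field of the plane quartic is `K(x)[y]/(y³ - g)` -/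

section SchemeFunctionField

open SmoothHypersurface CategoryTheory _root_.AlgebraicGeometry Literature.NumberTheory.GaloisRepresentations

variable {K : Type u} [Field K] {g : Polynomial K}

/-- `X_F` is an integral scheme (`3 ≠ 0`, `g` a separable quartic). [folklore] -/
theorem isIntegral_hypersurface_picardForm (h3 : (3 : K) ≠ 0) (hg : g.natDegree = 4) (hsep : g.Separable) :
    IsIntegral (hypersurface (picardForm g)).left :=
  IsSmoothProjective.isIntegral_holds (isSmoothProjective_hypersurface_picardForm h3 hg hsep)

variable (hsep : g.Separable) (hg : g.natDegree = 4)

/-- `Spec R` over `K` is affine (instance through the `specOver` wrapper). [folklore] -/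
instance isAffine_specOver_left (R : Type u) [CommRing R] [Algebra K R] : IsAffine (specOver K R).left :=
  inferInstanceAs (IsAffine (Spec _))

/-- The open `z ≠ 0` of `X_F` (the image of the affine chart). [folklore] -/
def chartOpen : (hypersurface (picardForm g)).left.Opens := (affineChart hsep hg).left ''ᵁ ⊤

/-- `chartOpen` is the range of the affine chart. [folklore] -/
theorem chartOpen_eq_opensRange : chartOpen hsep hg = (affineChart hsep hg).left.opensRange :=
  Scheme.Hom.image_top_eq_opensRange _

/-- `{z ≠ 0}` is an affine open. [folklore] -/
theorem isAffineOpen_chartOpen : IsAffineOpen (chartOpen hsep hg) := by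
  rw [chartOpen_eq_opensRange]
  exact isAffineOpen_opensRange _

/-- `{z ≠ 0}` is non-empty. [folklore] -/
instance nonempty_chartOpen : Nonempty (chartOpen hsep hg) := by
  have hdeg : (cubicPoly g).degree ≠ 0 := by
    rw [Polynomial.degree_X_pow_sub_C (by norm_num) g]; norm_num
  haveI : Nontrivial (affineRing g) := (AdjoinRoot.of.injective_of_degree_ne_zero hdeg).nontrivial
  obtain ⟨x⟩ : Nonempty (Spec (CommRingCat.of (affineRing g)) : Scheme.{u}) := inferInstance
  exact ⟨⟨(affineChart hsep hg).left x, by rw [chartOpen_eq_opensRange]; exact ⟨x, rfl⟩⟩⟩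

/-- **`Γ(X_F, {z ≠ 0}) ≅ K[x][y]/(y³ - g)`** (sections over the image of an open immersion, Mathlib
`Scheme.Hom.appIso`, and `Γ(Spec A) = A`). [folklore] -/
def sectionsChartOpenEquiv : Γ((hypersurface (picardForm g)).left, chartOpen hsep hg) ≃+* affineRing g :=
  (((affineChart hsep hg).left.appIso ⊤) ≪≫ Scheme.ΓSpecIso (CommRingCat.of (affineRing g))).commRingCatIsoToRingEquiv

variable [Fact (Irreducible (superellipticPoly K K 3 g))] [IsIntegral (hypersurface (picardForm g)).left]

/-- **The function field of the Picard quartic is `K(x)[y]/(y³ - g)`**: a ring isomorphism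
`K(X_F) ≅ SuperellipticFunctionField K K 3 g` (both are fields of fractions of
`K[x][y]/(y³ - g) ≅ Γ(X_F, {z ≠ 0})`: Mathlib `functionField_isFractionRing_of_isAffineOpen` and
`isFractionRing_functionField`); integrality of `X_F` (`isIntegral_hypersurface_picardForm`) is taken
as an instance hypothesis. [folklore] -/
def functionFieldEquiv :
    (hypersurface (picardForm g)).left.functionField ≃+* SuperellipticFunctionField K K 3 g := by
  haveI hfr := functionField_isFractionRing_of_isAffineOpen (hypersurface (picardForm g)).left
    (chartOpen hsep hg) (isAffineOpen_chartOpen hsep hg)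
  letI alg : Algebra (affineRing g) (hypersurface (picardForm g)).left.functionField :=
    ((algebraMap Γ((hypersurface (picardForm g)).left, chartOpen hsep hg) _).comp
      (sectionsChartOpenEquiv hsep hg).symm.toRingHom).toAlgebra
  haveI : IsFractionRing (affineRing g) (hypersurface (picardForm g)).left.functionField :=
    (IsFractionRing.isFractionRing_iff_of_base_ringEquiv _ (sectionsChartOpenEquiv hsep hg)).mp hfr
  exact (IsLocalization.algEquiv (nonZeroDivisors (affineRing g))
    ((hypersurface (picardForm g)).left.functionField) (SuperellipticFunctionField K K 3 g)).toRingEquiv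

end SchemeFunctionField

end Literature.AlgebraicGeometry.Motives.PicardQuartic

end
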